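import Summits.Ventures.PercRepro.Night2TwoOneTypes
import Summits.Ventures.PercRepro.Night2TwoOneArith

/-!
# PercRepro — the cell `(2, 1)` with two fat closures: the mass of a target through its type-A bases
(night-2, gen 27)

Groundwork for the `(2, 1)` nested residue, continued.  With `P = (cl B₀ ∩ cl B₁) ∖ K` the plane of the two fat
closures, the covering bases of a target with at most two points on `P` lose nothing (`Night2TwoOneTypes`), and every
covering basis loses at most the chord `E(n) = (19 n + 193)/(72 (n − 2))` of gen 24 (`chord_twoone`,
`sum_faceLoss_union_le`).  So the non-big mass of a target `S` is at most `C(|S′ ∩ P|, 3) · C(|S′ ∖ P|, 2) · E(n)/D`,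
`S′ = S ∖ K`, `D = 2^{n−5} − 1`: the count of the `5`-subsets with exactly three points on the plane.

* `card_coverBases_filter_le'`: the covering bases (`ρ = 5`) with exactly `k` points on a set number at most
  `C(i, k) · C(j, 5 − k)`;
* `faceLoss_sum_le_two_one`: the chord at every covering basis of the cell `(2, 1)`, `n ≥ 9`;
* **`pi2MassH_le_plane_two_one`**: the mass bound along the plane.
-/

namespace PercRepro.Shadow

open Finset PerFlat ThmH

variable {α : Type*} [DecidableEq α] {M : Matroid α} [M.Finite]

section TwoOneMass

variable {G : Finset α}

open scoped Classical in
/-- The covering bases (`ρ = 5`) of `S` with exactly `k` points on `ℓ` number at most `C(i, k) · C(j, 5 − k)`. -/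
theorem card_coverBases_filter_le' (S ℓ : Finset α) (k : ℕ) :
    ((coverBases M G S 5).filter (fun T => (T ∩ ℓ).card = k)).card ≤
      ((S \ coloops M G) ∩ ℓ).card.choose k * ((S \ coloops M G) \ ℓ).card.choose (5 - k) := by
  have hsub : (coverBases M G S 5).filter (fun T => (T ∩ ℓ).card = k) ⊆
      ((S \ coloops M G).powersetCard 5).filter (fun T => (T ∩ ((S \ coloops M G) ∩ ℓ)).card = k) := by
    intro T hT
    rw [Finset.mem_filter] at hT
    obtain ⟨hT1, hT2⟩ := hT
    unfold coverBases at hT1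
    rw [Finset.mem_filter] at hT1
    rw [Finset.mem_filter]
    refine ⟨hT1.1, ?_⟩
    have hTS : T ⊆ S \ coloops M G := (Finset.mem_powersetCard.1 hT1.1).1
    have : T ∩ ((S \ coloops M G) ∩ ℓ) = T ∩ ℓ := by
      ext a
      simp only [Finset.mem_inter]
      constructor
      · rintro ⟨haT, -, haℓ⟩; exact ⟨haT, haℓ⟩
      · rintro ⟨haT, haℓ⟩; exact ⟨haT, hTS haT, haℓ⟩
    rw [this]; exact hT2
  refine (Finset.card_le_card hsub).trans ?_
  -- the `5`-subsets of `S′` with exactly `k` points in `A = S′ ∩ ℓ`: choose `k` in `A` and `5 − k` in `S′ ∖ A`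
  set A := (S \ coloops M G) ∩ ℓ with hA
  have hAS : A ⊆ S \ coloops M G := Finset.inter_subset_left
  have hcompl : (S \ coloops M G) \ A = (S \ coloops M G) \ ℓ := by
    ext a
    simp only [hA, Finset.mem_sdiff, Finset.mem_inter, not_and]
    constructor
    · rintro ⟨ha, h⟩; exact ⟨ha, fun haℓ => h ha haℓ⟩
    · rintro ⟨ha, h⟩; exact ⟨ha, fun _ => h⟩
  rw [← hcompl, ← Finset.card_powersetCard, ← Finset.card_powersetCard, ← Finset.card_product]
  apply Finset.card_le_card_of_injOn (fun T => (T ∩ A, T \ A))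
  · intro T hT
    rw [Finset.mem_coe, Finset.mem_filter, Finset.mem_powersetCard] at hT
    obtain ⟨⟨hTS, hT5⟩, hTk⟩ := hT
    rw [Finset.mem_coe, Finset.mem_product, Finset.mem_powersetCard, Finset.mem_powersetCard]
    refine ⟨⟨Finset.inter_subset_right, hTk⟩, Finset.sdiff_subset_sdiff hTS (Finset.Subset.refl _), ?_⟩
    show (T \ A).card = 5 - k
    have h := Finset.card_sdiff_add_card_inter T A
    rw [hTk] at h
    omega
  · intro T hT T' hT' heq
    simp only [Prod.mk.injEq] at heq
    rw [← Finset.sdiff_union_inter T A, ← Finset.sdiff_union_inter T' A, heq.1, heq.2]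

open scoped Classical in
/-- **The chord at a covering basis of the cell `(2, 1)`** (`n ≥ 9`): the face losses of `K ∪ T` sum to at most
`(19 n + 193)/(72 (n − 2))`. -/
theorem faceLoss_sum_le_two_one (hG : G ∈ flatsQ M (5 + 1)) (hd : (gr M \ G).card = 2) (hk : kColoops M G = 1)
    (hs : ∀ e ∈ gr M, ∀ f ∈ gr M, e ≠ f → rkN M {e, f} = 2) (hl : ∀ e ∈ gr M, M.Indep {e})
    (h9 : 9 ≤ (G \ coloops M G).card) {S : Finset α} {T : Finset α} (hT : T ∈ coverBases M G S 5) :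
    ∑ w ∈ T, faceLoss M 5 G (coloops M G ∪ T) w ≤
      (19 * ((G \ coloops M G).card : ℚ) + 193) / (72 * (((G \ coloops M G).card : ℚ) - 2)) := by
  have hk' : kColoops M G + 5 = 5 + 1 := by omega
  have hT' : T ∈ (S \ coloops M G).powersetCard 5 := by
    unfold coverBases at hT
    exact (Finset.mem_filter.1 hT).1
  set n := (G \ coloops M G).card with hn
  have hn' : (9 : ℚ) ≤ (n : ℚ) := by exact_mod_cast h9
  have h := sum_faceLoss_union_le (a := (n : ℚ) / (4 * ((n : ℚ) - 2))) (b := 1 / (4 * ((n : ℚ) - 2))) hG hd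
    (by norm_num) hk' (by omega) hs hl (le_of_lt (div_pos one_pos (by linarith)))
    (chord_twoone h9) (by rw [hk, excessBound_twoone_eq h9]; exact (excess_twoone_pos h9).le) hT'
  rw [hk, excessBound_twoone_eq h9] at h
  exact h

open scoped Classical in
/-- **THE MASS OF A TARGET ALONG THE PLANE** (cell `(2, 1)`, two fat closures, `n ≥ 9`): the non-big mass of
`S ⊆ G` is at most `C(|S′ ∩ P|, 3) · C(|S′ ∖ P|, 2) · E(n)/(2^{n−5} − 1)`, `S′ = S ∖ K`, `P = (cl B₀ ∩ cl B₁) ∖ K` —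
only the covering bases with three points on the plane lose. -/
theorem pi2MassH_le_plane_two_one (hG : G ∈ flatsQ M (5 + 1)) (hd : (gr M \ G).card = 2) (hk : kColoops M G = 1)
    (hs : ∀ e ∈ gr M, ∀ f ∈ gr M, e ≠ f → rkN M {e, f} = 2) (hl : ∀ e ∈ gr M, M.Indep {e})
    (h9 : 9 ≤ (G \ coloops M G).card) {B₀ B₁ : Finset α} (hB₀ : B₀ ∈ thinMembers M 5 G)
    (hB₁ : B₁ ∈ thinMembers M 5 G) (hm₀ : (G \ clF M B₀).card ≤ 2) (hm₁ : (G \ clF M B₁).card ≤ 2)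
    (hne : clF M B₀ ≠ clF M B₁) {S : Finset α} (hSG : S ⊆ G) :
    pi2MassH M 5 G (fun B => 5 ≤ (B \ coloops M G).card) S ≤
      ((((S \ coloops M G) ∩ ((clF M B₀ ∩ clF M B₁) \ coloops M G)).card.choose 3 *
        ((S \ coloops M G) \ ((clF M B₀ ∩ clF M B₁) \ coloops M G)).card.choose 2 : ℕ) : ℚ) *
        ((19 * ((G \ coloops M G).card : ℚ) + 193) / (72 * (((G \ coloops M G).card : ℚ) - 2)) /
          ((2 ^ ((G \ coloops M G).card - 5) - 1 : ℕ) : ℚ)) := by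
  have hd' : (gr M \ G).card ≤ 5 := by omega
  have hk' : kColoops M G + 5 = 5 + 1 := by omega
  have hKG : coloops M G ⊆ G := fun y hy => (mem_coloops.1 hy).1
  have hGn : G.card - kColoops M G = (G \ coloops M G).card := by
    rw [Finset.card_sdiff_of_subset hKG, kColoops_eq_card_coloops]
  have hP' : ∀ B ∈ thinMembers M 5 G, ¬ (5 ≤ (B \ coloops M G).card) → (B \ coloops M G).card + 1 = 5 := by
    intro B hB hnP
    have h4 := card_sdiff_coloops_thin_ge hG hd' hk' hB
    omega
  set P := (clF M B₀ ∩ clF M B₁) \ coloops M G with hP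
  set n := (G \ coloops M G).card with hn
  set E : ℚ := (19 * (n : ℚ) + 193) / (72 * ((n : ℚ) - 2)) with hE
  set D : ℚ := ((2 ^ (n - 5) - 1 : ℕ) : ℚ) with hD
  have hn' : (9 : ℚ) ≤ (n : ℚ) := by exact_mod_cast h9
  have hE0 : 0 ≤ E := by rw [hE]; apply div_nonneg <;> linarith
  have hD0 : 0 ≤ D := by positivity
  have h1 := pi2MassH_le_sum_coverBases hG hd (by norm_num) hk' hP' S
  rw [hGn] at h1
  -- a covering basis has at most three points on the plane; with fewer it loses nothing
  have hsplit : ∑ X ∈ coverBases M G S 5, (∑ w ∈ X, faceLoss M 5 G (coloops M G ∪ X) w) / D ≤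
      ∑ _X ∈ (coverBases M G S 5).filter (fun X => (X ∩ P).card = 3), E / D := by
    rw [← Finset.sum_filter_add_sum_filter_not (coverBases M G S 5) (fun X => (X ∩ P).card = 3)]
    have hzero : ∑ X ∈ (coverBases M G S 5).filter (fun X => ¬ (X ∩ P).card = 3),
        (∑ w ∈ X, faceLoss M 5 G (coloops M G ∪ X) w) / D = 0 := by
      apply Finset.sum_eq_zero
      intro X hX
      rw [Finset.mem_filter] at hX
      obtain ⟨hX, hne3⟩ := hX
      have hX' := hX
      unfold coverBases at hX'
      rw [Finset.mem_filter, Finset.mem_powersetCard] at hX'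
      obtain ⟨⟨hXS, hX5⟩, hXI⟩ := hX'
      have hXV : X ⊆ G \ coloops M G := hXS.trans (Finset.sdiff_subset_sdiff hSG (Finset.Subset.refl _))
      -- `|X ∩ P| ≤ 3` by the rank of the plane
      have hle3 : (X ∩ P).card ≤ 3 := by
        have hXI' : M.Indep (X : Set α) :=
          hXI.subset (by exact_mod_cast (Finset.subset_union_right : X ⊆ coloops M G ∪ X))
        have hI : M.Indep ((X ∩ P : Finset α) : Set α) :=
          hXI'.subset (by exact_mod_cast (Finset.inter_subset_left : X ∩ P ⊆ X))
        have h1 := rkN_eq_card_of_indep hI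
        have h2 : rkN M (X ∩ P) ≤ rkN M P := rkN_mono Finset.inter_subset_right
        -- the plane has rank `≤ 3` (two distinct hyperplanes)
        have hPr : rkN M P ≤ 3 := by
          have hB₀' : B₀ ∈ membersIn M (Uq M (5 + 2) 5) G := (mem_thinMembers.1 hB₀).1
          have hB₁' : B₁ ∈ membersIn M (Uq M (5 + 2) 5) G := (mem_thinMembers.1 hB₁).1
          have hB₀U : B₀ ∈ Uq M (5 + 2) 5 := (mem_membersIn.1 hB₀').1
          have hB₁U : B₁ ∈ Uq M (5 + 2) 5 := (mem_membersIn.1 hB₁').1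
          have hH₀G : clF M B₀ ⊆ G := (mem_membersIn.1 hB₀').2
          have hH₁G : clF M B₁ ⊆ G := (mem_membersIn.1 hB₁').2
          have hKH₀ : coloops M G ⊆ clF M B₀ :=
            (coloops_subset_of_mem_thinMembers hG hd' hB₀).trans (subset_clF hB₀U)
          have hKH₁ : coloops M G ⊆ clF M B₁ :=
            (coloops_subset_of_mem_thinMembers hG hd' hB₁).trans (subset_clF hB₁U)
          by_cases hsub : clF M B₁ ⊆ clF M B₀
          · have hex : ∃ y ∈ clF M B₀, y ∉ clF M B₁ := by
              by_contra hcon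
              push Not at hcon
              exact hne (Finset.Subset.antisymm hcon hsub)
            obtain ⟨y, hyH₀, hyH₁⟩ := hex
            have := rkN_inter_sdiff_coloops_le_three_of_hyperplanes_two hG hk hH₁G hH₀G (clF_clF B₁)
              (rkN_clF_eq_five_of_mem_Uq hB₁U) (rkN_clF_eq_five_of_mem_Uq hB₀U).le hKH₁ hKH₀ hyH₀ hyH₁
            rwa [Finset.inter_comm] at this
          · obtain ⟨y, hyH₁, hyH₀⟩ := Finset.not_subset.1 hsub
            exact rkN_inter_sdiff_coloops_le_three_of_hyperplanes_two hG hk hH₀G hH₁G (clF_clF B₀)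
              (rkN_clF_eq_five_of_mem_Uq hB₀U) (rkN_clF_eq_five_of_mem_Uq hB₁U).le hKH₀ hKH₁ hyH₁ hyH₀
        omega
      have hle2 : (X ∩ P).card ≤ 2 := by omega
      rw [faceLoss_sum_eq_zero_of_two_off_plane hG hd hk hB₀ hB₁ hm₀ hm₁ hne hXV hX5 hle2, zero_div]
    rw [hzero, add_zero]
    apply Finset.sum_le_sum
    intro X hX
    have hX' := (Finset.mem_filter.1 hX).1
    exact div_le_div_of_nonneg_right (faceLoss_sum_le_two_one hG hd hk hs hl h9 hX') hD0
  rw [Finset.sum_const, nsmul_eq_mul] at hsplit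
  have hcount := card_coverBases_filter_le' (M := M) (G := G) S P 3
  have hcount' : (((coverBases M G S 5).filter (fun X => (X ∩ P).card = 3)).card : ℚ) ≤
      ((((S \ coloops M G) ∩ P).card.choose 3 * ((S \ coloops M G) \ P).card.choose 2 : ℕ) : ℚ) := by
    have h53 : (5 : ℕ) - 3 = 2 := rfl
    rw [h53] at hcount
    exact_mod_cast hcount
  calc pi2MassH M 5 G (fun B => 5 ≤ (B \ coloops M G).card) S ≤ _ := h1
    _ ≤ _ := hsplit
    _ ≤ _ := mul_le_mul_of_nonneg_right hcount' (div_nonneg hE0 hD0)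

end TwoOneMass

end PercRepro.Shadow
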